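import Summits.QuantumFields.BalabanUV.InfraRed.StrongCouplingSharpTwist
import Literature.MathematicalPhysics.QuantumFieldTheory.Balaban1983to89.StrongCouplingVarianceWindow
import HarnessLib

/-!
# Strong-coupling front, J-SC16c: ALL Haar moments of a coordinate of `SU(2)` in closed form —
observatory of the non-perturbative crossover; no mass-gap claim

IR-3 v2 TWO-FRONT CROSSOVER LEDGER, front SC (`β₀`), SU(2), `d = 4`, Wilson normalisation `β_W = 4/g²`.
ABSOLUTE RULE of this package: No internally-minted statement may enter as a cited fact. Every hypothesis is either
kernel-proved in this package or a verbatim quotation of a PUBLISHED theorem with page reference. The manuscript(s)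
under audit are NOT citable for their own disputed steps — they are the thing under adjudication; programme-internal
(2001/route/tribunal) claims are never citable. Nothing is cited in this file: every statement is elementary and
proved here ([folklore] labels are attributions, not citations).

WHAT THIS FILE PROVES (first brick of the kernel port of the ball-flux certificate for `QuarterCovariance`,
FRONT-SC §3n; the certificate is an inequality between power series whose coefficients are these moments):
* `integral_re_pow_add_two`: the **moment recursion** `∫ x₀^(n+2) dσ = (n+1)/(n+4) · ∫ x₀^n dσ` for the Haar
  probability measure `σ` of `SU(2)` and the real coordinate `x₀ = Re g₀₀` (all `n : ℕ`);
* `integral_re_pow_even`: the closed form `∫ x₀^(2j) dσ = binom(2j, j) / (4^j (j+1)) = Catalan_j / 4^j`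
  (`integral_re_pow_even_catalan`), and `integral_re_mul_star_pow_even`: the same for every coordinate `⟨x, u⟩`,
  `|u| = 1`;
* `hasSum_integral_pow_mul_exp`: the EXPONENTIAL MOMENTS as power series in the tilt,
  `∫ x₀^k e^{κ x₀} dσ = Σ_n κ^n/n! ∫ x₀^(k+n) dσ` (all `k`, all real `κ`; `integral_dir_pow_mul_exp` for every axis) —
  so every integral of the certificate is an explicit series with rational coefficients;
* on the way, `Gam_pot_one_ae`: the carré du champ of the axis potential is `Γ(x₀, x₀) = (1 − x₀²)/2` σ-a.e.
METHOD: integration by parts on `SU(2)` in the tree's frame calculus (`integral_matD_frame_eq_zero`) applied to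
`x₀^(n+1) D_α x₀`, the Casimir identity `Δ x₀ = -(3/2) x₀` (`Lap_potential_two`) and Bessel's inequality
`Γ(x₀,x₀) + x₀²·(1/2)·… ≤ 1/2` (`Gam_potential_add_sq_le`), whose equality case is forced by comparing integrals
(`∫ Γ = 3/8`).  No smallness, no numerics.

NOT CLAIMED: anything about tilted measures; no mass-gap claim.
-/

noncomputable section

open MeasureTheory Filter Finset Real
open scoped NNReal Quaternion Matrix ComplexConjugate BigOperators Matrix.Norms.Frobenius ContDiff Topology Nat
open Matrix Complex
open Literature.MathematicalPhysics.QuantumLattice (su2Quat)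
open Literature.MathematicalPhysics.QuantumFieldTheory
open Literature.MathematicalPhysics.QuantumFieldTheory.SUNBakryEmery
open Literature.MathematicalPhysics.QuantumFieldTheory.Balaban1983to89.StrongCouplingVarianceWindow (qp
  re_trace_eq_two_mul_re integral_re_sq integral_comp_units)
open Summit.QuantumFields.BalabanUV.InfraRed.StrongCouplingDimensionalCurvature (Gam_potential_add_sq_le)
open Summit.QuantumFields.BalabanUV.InfraRed.StrongCouplingSharpTwist (Lap_potential_two)

namespace Summit.QuantumFields.BalabanUV.InfraRed.StrongCouplingHaarMoments

local notation "SU2" => Matrix.specialUnitaryGroup (Fin 2) ℂ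
local notation "M₂" => Matrix (Fin 2) (Fin 2) ℂ
local notation "σ₂" => haarProbability (Matrix.specialUnitaryGroup (Fin 2) ℂ)

/-- The axis potential `S(Q) = ½ Re tr Q`; on `SU(2)` it is the real coordinate `x₀`. [folklore] -/
theorem pot_half_one_apply (g : SU2) : pot (1 / 2 : ℝ) (1 : M₂) (g : M₂) = (su2Quat g).re := by
  have hqp : qp (1 : M₂) = 1 := by
    ext <;> simp [qp]
  show (1 / 2 : ℝ) * ((g : M₂) * 1).trace.re = (su2Quat g).re
  rw [re_trace_eq_two_mul_re, hqp, mul_one]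
  ring

/-- **Integration by parts against the axis potential**: for every `n`,
`∫ (S^(n+1) ΔS + (n+1) S^n Γ(S,S)) dσ = 0` (sum over the frame of `∫ D_α(S^(n+1) D_α S) dσ = 0`). [folklore] -/
theorem integral_pow_Lap_add_Gam (n : ℕ) :
    ∫ g : SU2, ((pot (1 / 2 : ℝ) (1 : M₂) (g : M₂)) ^ (n + 1) * Lap (pot (1 / 2 : ℝ) (1 : M₂)) (g : M₂) +
      (n + 1) * (pot (1 / 2 : ℝ) (1 : M₂) (g : M₂)) ^ n *
        Gam (pot (1 / 2 : ℝ) (1 : M₂)) (pot (1 / 2 : ℝ) (1 : M₂)) (g : M₂)) ∂σ₂ = 0 := by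
  set S : M₂ → ℝ := pot (1 / 2 : ℝ) (1 : M₂) with hS
  have hSc : ContDiff ℝ ∞ S := contDiff_pot _ _
  have hPc : ContDiff ℝ ∞ (fun Q => S Q ^ (n + 1)) := hSc.pow _
  -- the fields `F_α = S^(n+1) D_α S`
  set F : FrameIdx 2 → M₂ → ℝ := fun α Q => S Q ^ (n + 1) * matD (frame α) S Q with hF
  have hFc : ∀ α, ContDiff ℝ ∞ (F α) := fun α => hPc.mul (contDiff_matD hSc _)
  -- pointwise: `D_α F_α = S^(n+1) D_α D_α S + (n+1) S^n (D_α S)²`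
  have hd : ∀ y : ℝ, deriv (fun x : ℝ => x ^ (n + 1)) y = (n + 1) * y ^ n := fun y => by
    rw [(hasDerivAt_pow (n + 1) y).deriv]
    push_cast
    simp
  have hpt : ∀ α (Q : M₂), matD (frame α) (F α) Q =
      S Q ^ (n + 1) * matD (frame α) (matD (frame α) S) Q + (n + 1) * S Q ^ n * matD (frame α) S Q ^ 2 := by
    intro α Q
    have h1 : matD (frame α) (F α) = fun Q => S Q ^ (n + 1) * matD (frame α) (matD (frame α) S) Q +
        matD (frame α) S Q * matD (frame α) (fun Q => S Q ^ (n + 1)) Q := matD_fun_mul hPc (contDiff_matD hSc _) _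
    have h2 : matD (frame α) (fun Q => S Q ^ (n + 1)) = fun Q => deriv (fun x : ℝ => x ^ (n + 1)) (S Q) * matD (frame α) S Q :=
      matD_comp hSc (contDiff_id.pow _) _
    rw [h1]
    simp only
    rw [h2]
    simp only
    rw [hd]
    ring
  -- sum over the frame
  have hsum : ∀ Q : M₂, ∑ α, matD (frame α) (F α) Q =
      S Q ^ (n + 1) * Lap S Q + (n + 1) * S Q ^ n * Gam S S Q := by
    intro Q
    simp_rw [hpt]
    rw [sum_add_distrib, ← mul_sum, ← mul_sum, Gam_self_eq_sum_sq]
    rfl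
  -- integrate: each `∫ D_α F_α dσ = 0`
  have hint : ∀ α, Integrable (fun g : SU2 => matD (frame α) (F α) (g : M₂)) σ₂ := fun α =>
    integrable_of_continuous_SUN (continuous_restrict (contDiff_matD (hFc α) _)) _
  have h0 : ∫ g : SU2, ∑ α, matD (frame α) (F α) (g : M₂) ∂σ₂ = 0 := by
    rw [integral_finsetSum _ fun α _ => hint α]
    exact sum_eq_zero fun α _ => integral_matD_frame_eq_zero two_ne_zero (hFc α) α
  simpa only [hsum] using h0

/-- The recursion in raw form: `(3/2) ∫ x₀^(n+2) dσ = (n+1) ∫ x₀^n Γ(S,S) dσ`. [folklore] -/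
theorem integral_pow_Gam (n : ℕ) :
    (3 / 2) * ∫ g : SU2, (su2Quat g).re ^ (n + 2) ∂σ₂ =
      (n + 1) * ∫ g : SU2, (su2Quat g).re ^ n * Gam (pot (1 / 2 : ℝ) (1 : M₂)) (pot (1 / 2 : ℝ) (1 : M₂)) (g : M₂) ∂σ₂ := by
  have h := integral_pow_Lap_add_Gam n
  have hL : ∀ g : SU2, Lap (pot (1 / 2 : ℝ) (1 : M₂)) (g : M₂) = -(3 / 2) * pot (1 / 2 : ℝ) (1 : M₂) (g : M₂) :=
    fun g => Lap_potential_two (1 / 2) 1 (g : M₂)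
  simp_rw [hL, pot_half_one_apply] at h
  have hGc : Continuous fun g : SU2 => Gam (pot (1 / 2 : ℝ) (1 : M₂)) (pot (1 / 2 : ℝ) (1 : M₂)) (g : M₂) :=
    continuous_restrict (contDiff_Gam (contDiff_pot _ _) (contDiff_pot _ _))
  have hre : Continuous fun g : SU2 => (su2Quat g).re := by
    have : Continuous fun g : SU2 => pot (1 / 2 : ℝ) (1 : M₂) (g : M₂) := continuous_restrict (contDiff_pot _ _)
    simpa only [pot_half_one_apply] using this
  have i1 : Integrable (fun g : SU2 => (su2Quat g).re ^ (n + 1) * (-(3 / 2) * (su2Quat g).re)) σ₂ :=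
    integrable_of_continuous_SUN ((hre.pow _).mul (continuous_const.mul hre)) _
  have i2 : Integrable (fun g : SU2 => ((n : ℝ) + 1) * (su2Quat g).re ^ n *
      Gam (pot (1 / 2 : ℝ) (1 : M₂)) (pot (1 / 2 : ℝ) (1 : M₂)) (g : M₂)) σ₂ :=
    integrable_of_continuous_SUN ((continuous_const.mul (hre.pow _)).mul hGc) _
  rw [integral_add i1 i2] at h
  have e1 : ∫ g : SU2, (su2Quat g).re ^ (n + 1) * (-(3 / 2) * (su2Quat g).re) ∂σ₂ =
      -(3 / 2) * ∫ g : SU2, (su2Quat g).re ^ (n + 2) ∂σ₂ := by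
    rw [← integral_const_mul]
    refine integral_congr_ae (ae_of_all _ fun g => ?_)
    simp only
    ring
  have e2 : ∫ g : SU2, ((n : ℝ) + 1) * (su2Quat g).re ^ n *
      Gam (pot (1 / 2 : ℝ) (1 : M₂)) (pot (1 / 2 : ℝ) (1 : M₂)) (g : M₂) ∂σ₂ =
      ((n : ℝ) + 1) * ∫ g : SU2, (su2Quat g).re ^ n * Gam (pot (1 / 2 : ℝ) (1 : M₂)) (pot (1 / 2 : ℝ) (1 : M₂)) (g : M₂) ∂σ₂ := by
    rw [← integral_const_mul]
    refine integral_congr_ae (ae_of_all _ fun g => ?_)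
    simp only
    ring
  rw [e1, e2] at h
  linarith

/-- **The carré du champ of the axis potential is `(1 − x₀²)/2` σ-almost everywhere** (Bessel's inequality gives
`≤` pointwise on `SU(2)`; the integrals agree: `∫ Γ = (3/2) ∫ x₀² = 3/8 = ∫ (1 − x₀²)/2`). [folklore] -/
theorem Gam_pot_one_ae :
    (fun g : SU2 => Gam (pot (1 / 2 : ℝ) (1 : M₂)) (pot (1 / 2 : ℝ) (1 : M₂)) (g : M₂)) =ᵐ[σ₂]
      fun g => (1 - (su2Quat g).re ^ 2) / 2 := by
  set G : SU2 → ℝ := fun g => Gam (pot (1 / 2 : ℝ) (1 : M₂)) (pot (1 / 2 : ℝ) (1 : M₂)) (g : M₂) with hG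
  have hre : Continuous fun g : SU2 => (su2Quat g).re := by
    have : Continuous fun g : SU2 => pot (1 / 2 : ℝ) (1 : M₂) (g : M₂) := continuous_restrict (contDiff_pot _ _)
    simpa only [pot_half_one_apply] using this
  have hGc : Continuous G := continuous_restrict (contDiff_Gam (contDiff_pot _ _) (contDiff_pot _ _))
  -- pointwise upper bound from Bessel
  have hle : ∀ g : SU2, G g ≤ (1 - (su2Quat g).re ^ 2) / 2 := by
    intro g
    have hB := Gam_potential_add_sq_le (1 / 2 : ℝ) (1 : M₂) (Q := (g : M₂)) (SUN.mem_unitaryGroup g)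
    have h1 : frobNorm (1 : M₂) ^ 2 = 2 := by
      rw [frobNorm, Real.sq_sqrt (by positivity)]
      simp [Fin.sum_univ_two, Matrix.one_apply]
      norm_num
    have hpot : (1 / 2 : ℝ) * ((g : M₂) * 1).trace.re = (su2Quat g).re := pot_half_one_apply g
    rw [h1, hpot] at hB
    have : G g = Gam (fun Q : M₂ => (1 / 2 : ℝ) * (Q * 1).trace.re) (fun Q : M₂ => (1 / 2 : ℝ) * (Q * 1).trace.re) (g : M₂) := rfl
    rw [this]
    linarith
  -- the integrals agree
  have hint : ∫ g : SU2, G g ∂σ₂ = 3 / 8 := by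
    have h := integral_pow_Gam 0
    simp only [Nat.cast_zero, zero_add, one_mul, pow_zero] at h
    rw [integral_re_sq] at h
    linarith
  have hint2 : ∫ g : SU2, (1 - (su2Quat g).re ^ 2) / 2 ∂σ₂ = 3 / 8 := by
    have i0 : Integrable (fun g : SU2 => (1 : ℝ) / 2) σ₂ := integrable_const _
    have i2 : Integrable (fun g : SU2 => (su2Quat g).re ^ 2 / 2) σ₂ :=
      integrable_of_continuous_SUN ((hre.pow 2).div_const _) _
    have e : (fun g : SU2 => (1 - (su2Quat g).re ^ 2) / 2) = fun g => 1 / 2 - (su2Quat g).re ^ 2 / 2 := by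
      funext g; ring
    rw [e, integral_sub i0 i2, integral_const, integral_div, integral_re_sq]
    simp
    norm_num
  -- a nonnegative function with zero integral vanishes a.e.
  have hnn : 0 ≤ᵐ[σ₂] fun g => (1 - (su2Quat g).re ^ 2) / 2 - G g :=
    ae_of_all _ fun g => sub_nonneg.2 (hle g)
  have hi : Integrable (fun g : SU2 => (1 - (su2Quat g).re ^ 2) / 2 - G g) σ₂ :=
    integrable_of_continuous_SUN (((continuous_const.sub (hre.pow 2)).div_const _).sub hGc) _
  have iA : Integrable (fun g : SU2 => (1 - (su2Quat g).re ^ 2) / 2) σ₂ :=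
    integrable_of_continuous_SUN ((continuous_const.sub (hre.pow 2)).div_const _) _
  have iG : Integrable G σ₂ := integrable_of_continuous_SUN hGc _
  have hz : ∫ g : SU2, ((1 - (su2Quat g).re ^ 2) / 2 - G g) ∂σ₂ = 0 := by
    rw [integral_sub iA iG, hint, hint2, sub_self]
  have hae := (integral_eq_zero_iff_of_nonneg_ae hnn hi).1 hz
  filter_upwards [hae] with g hg
  simp only [Pi.zero_apply] at hg
  linarith

/-- **Moment recursion**: `∫ x₀^(n+2) dσ = (n+1)/(n+4) ∫ x₀^n dσ` for every `n : ℕ`. [folklore] -/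
theorem integral_re_pow_add_two (n : ℕ) :
    ∫ g : SU2, (su2Quat g).re ^ (n + 2) ∂σ₂ = (n + 1) / (n + 4) * ∫ g : SU2, (su2Quat g).re ^ n ∂σ₂ := by
  have h := integral_pow_Gam n
  have hre : Continuous fun g : SU2 => (su2Quat g).re := by
    have : Continuous fun g : SU2 => pot (1 / 2 : ℝ) (1 : M₂) (g : M₂) := continuous_restrict (contDiff_pot _ _)
    simpa only [pot_half_one_apply] using this
  have hG : ∫ g : SU2, (su2Quat g).re ^ n * Gam (pot (1 / 2 : ℝ) (1 : M₂)) (pot (1 / 2 : ℝ) (1 : M₂)) (g : M₂) ∂σ₂ =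
      ∫ g : SU2, (su2Quat g).re ^ n * ((1 - (su2Quat g).re ^ 2) / 2) ∂σ₂ := by
    refine integral_congr_ae ?_
    filter_upwards [Gam_pot_one_ae] with g hg
    rw [hg]
  have hsplit : ∫ g : SU2, (su2Quat g).re ^ n * ((1 - (su2Quat g).re ^ 2) / 2) ∂σ₂ =
      (1 / 2) * ∫ g : SU2, (su2Quat g).re ^ n ∂σ₂ - (1 / 2) * ∫ g : SU2, (su2Quat g).re ^ (n + 2) ∂σ₂ := by
    have i1 : Integrable (fun g : SU2 => (1 / 2 : ℝ) * (su2Quat g).re ^ n) σ₂ :=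
      integrable_of_continuous_SUN (continuous_const.mul (hre.pow _)) _
    have i2 : Integrable (fun g : SU2 => (1 / 2 : ℝ) * (su2Quat g).re ^ (n + 2)) σ₂ :=
      integrable_of_continuous_SUN (continuous_const.mul (hre.pow _)) _
    rw [← integral_const_mul, ← integral_const_mul, ← integral_sub i1 i2]
    refine integral_congr_ae (ae_of_all _ fun g => ?_)
    simp only
    ring
  rw [hG, hsplit] at h
  have hn : (0 : ℝ) < n + 4 := by positivity
  field_simp
  linarith

/-- **All even moments in closed form**: `∫ x₀^(2j) dσ = binom(2j, j) / (4^j (j+1))` (`= 1, 1/4, 1/8, 5/64, 7/128, …`).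
[folklore] -/
theorem integral_re_pow_even (j : ℕ) :
    ∫ g : SU2, (su2Quat g).re ^ (2 * j) ∂σ₂ = (Nat.centralBinom j : ℝ) / (4 ^ j * (j + 1)) := by
  induction j with
  | zero => simp
  | succ j ih =>
    have h := integral_re_pow_add_two (2 * j)
    rw [show 2 * (j + 1) = 2 * j + 2 by ring, h, ih]
    have hc : ((j : ℝ) + 1) * (Nat.centralBinom (j + 1) : ℝ) = 2 * (2 * (j : ℝ) + 1) * (Nat.centralBinom j : ℝ) := by
      exact_mod_cast Nat.succ_mul_centralBinom_succ j
    have h1 : (0 : ℝ) < j + 1 := by positivity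
    have hc' : (Nat.centralBinom (j + 1) : ℝ) = 2 * (2 * (j : ℝ) + 1) * (Nat.centralBinom j : ℝ) / (j + 1) := by
      rw [eq_div_iff h1.ne']
      linarith [hc]
    rw [hc']
    push_cast
    have h2 : (0 : ℝ) < 2 * j + 4 := by positivity
    have h4 : (0 : ℝ) < 4 ^ j := by positivity
    field_simp
    ring

/-- The same in Catalan form: `∫ x₀^(2j) dσ = Catalan_j / 4^j`. [folklore] -/
theorem integral_re_pow_even_catalan (j : ℕ) :
    ∫ g : SU2, (su2Quat g).re ^ (2 * j) ∂σ₂ = (catalan j : ℝ) / 4 ^ j := by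
  rw [integral_re_pow_even, catalan_eq_centralBinom_div, Nat.cast_div (Nat.succ_dvd_centralBinom j) (by positivity)]
  push_cast
  rw [div_div]
  ring

/-- **Every coordinate has the same moments**: for a unit quaternion `u`, `∫ ⟨x, u⟩^n dσ = ∫ x₀^n dσ` with
`⟨x, u⟩ = Re(x ū)` (right translation by `ū`). [folklore] -/
theorem integral_re_mul_star_pow (n : ℕ) {u : ℍ} (hu : ‖u‖ = 1) :
    ∫ g : SU2, (su2Quat g * star u).re ^ n ∂σ₂ = ∫ g : SU2, (su2Quat g).re ^ n ∂σ₂ := by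
  have hsu : ‖star u‖ = 1 := by rw [norm_star]; exact hu
  have h := integral_comp_units (fun x : ℍ => x.re ^ n) norm_one hsu
  simpa only [one_mul] using h

/-- Closed form for every coordinate: `∫ ⟨x, u⟩^(2j) dσ = binom(2j, j) / (4^j (j+1))`. [folklore] -/
theorem integral_re_mul_star_pow_even (j : ℕ) {u : ℍ} (hu : ‖u‖ = 1) :
    ∫ g : SU2, (su2Quat g * star u).re ^ (2 * j) ∂σ₂ = (Nat.centralBinom j : ℝ) / (4 ^ j * (j + 1)) := by
  rw [integral_re_mul_star_pow _ hu, integral_re_pow_even]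

/-! ## Exponential moments as power series in the tilt (the coefficients of the ball-flux certificate) -/

/-- `|x₀| ≤ 1` on `SU(2)`. [folklore] -/
private theorem abs_re_su2Quat_le_one (g : SU2) : |(su2Quat g).re| ≤ 1 := by
  have h := Literature.MathematicalPhysics.QuantumFieldTheory.Balaban1983to89.StrongCouplingVarianceWindow.sq_sum_su2Quat g
  rw [abs_le]
  constructor <;> nlinarith [sq_nonneg (su2Quat g).imI, sq_nonneg (su2Quat g).imJ, sq_nonneg (su2Quat g).imK,
    sq_nonneg ((su2Quat g).re - 1), sq_nonneg ((su2Quat g).re + 1)]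

/-- The real coordinate is continuous on `SU(2)`. [folklore] -/
private theorem continuous_re_su2Quat : Continuous fun g : SU2 => (su2Quat g).re := by
  have : Continuous fun g : SU2 => pot (1 / 2 : ℝ) (1 : M₂) (g : M₂) := continuous_restrict (contDiff_pot _ _)
  simpa only [pot_half_one_apply] using this

/-- **Exponential moments are power series in the tilt with the Haar moments as coefficients**:
`∫ x₀^k e^{κ x₀} dσ = Σ_n κ^n/n! · ∫ x₀^(k+n) dσ` for every `k : ℕ` and every real `κ` (dominated convergence,
`|x₀| ≤ 1`). With `integral_re_pow_even` / `integral_re_pow_odd` every coefficient is an explicit rational. [folklore] -/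
theorem hasSum_integral_pow_mul_exp (k : ℕ) (κ : ℝ) :
    HasSum (fun n : ℕ => κ ^ n / (n ! : ℝ) * ∫ g : SU2, (su2Quat g).re ^ (k + n) ∂σ₂)
      (∫ g : SU2, (su2Quat g).re ^ k * Real.exp (κ * (su2Quat g).re) ∂σ₂) := by
  set F : ℕ → SU2 → ℝ := fun n g => κ ^ n / (n ! : ℝ) * (su2Quat g).re ^ (k + n) with hF
  have hre := continuous_re_su2Quat
  have hFi : ∀ n, Integrable (F n) σ₂ := fun n =>
    integrable_of_continuous_SUN (continuous_const.mul (hre.pow _)) _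
  -- `‖F n‖ ≤ |κ|^n / n!` pointwise, hence in mean
  have hFb : ∀ n (g : SU2), ‖F n g‖ ≤ |κ| ^ n / n ! := by
    intro n g
    rw [Real.norm_eq_abs, hF]
    simp only
    rw [abs_mul, abs_div, abs_pow, Nat.abs_cast, abs_pow]
    have h1 : |(su2Quat g).re| ^ (k + n) ≤ 1 := pow_le_one₀ (abs_nonneg _) (abs_re_su2Quat_le_one g)
    have h2 : 0 ≤ |κ| ^ n / n ! := by positivity
    calc |κ| ^ n / (n ! : ℝ) * |(su2Quat g).re| ^ (k + n) ≤ |κ| ^ n / (n ! : ℝ) * 1 :=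
          mul_le_mul_of_nonneg_left h1 h2
      _ = |κ| ^ n / n ! := mul_one _
  have hnorm : ∀ n, ∫ g : SU2, ‖F n g‖ ∂σ₂ ≤ |κ| ^ n / n ! := by
    intro n
    have h := integral_mono (hFi n).norm (integrable_const (|κ| ^ n / n !)) (hFb n)
    simpa using h
  have hsum : Summable fun n => ∫ g : SU2, ‖F n g‖ ∂σ₂ :=
    Summable.of_nonneg_of_le (fun n => integral_nonneg fun g => norm_nonneg _) hnorm
      (Real.summable_pow_div_factorial |κ|)
  -- pointwise power series of the exponential
  have hpt : ∀ g : SU2, HasSum (fun n => F n g) ((su2Quat g).re ^ k * Real.exp (κ * (su2Quat g).re)) := by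
    intro g
    have h := NormedSpace.expSeries_div_hasSum_exp (κ * (su2Quat g).re)
    rw [← congrFun Real.exp_eq_exp_ℝ (κ * (su2Quat g).re)] at h
    have h2 := h.mul_left ((su2Quat g).re ^ k)
    have hfun : (fun n => F n g) = fun n => (su2Quat g).re ^ k * ((κ * (su2Quat g).re) ^ n / (n ! : ℝ)) := by
      funext n
      rw [hF]
      simp only
      rw [mul_pow, pow_add]
      ring
    rw [hfun]
    exact h2
  -- interchange of sum and integral
  have h1 := integral_tsum_of_summable_integral_norm hFi hsum
  have h2 : ∫ g : SU2, (∑' n, F n g) ∂σ₂ = ∫ g : SU2, (su2Quat g).re ^ k * Real.exp (κ * (su2Quat g).re) ∂σ₂ :=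
    integral_congr_ae (ae_of_all _ fun g => (hpt g).tsum_eq)
  have hS : Summable fun n => ∫ g : SU2, F n g ∂σ₂ :=
    Summable.of_norm_bounded (g := fun n => |κ| ^ n / n !) (Real.summable_pow_div_factorial |κ|)
      fun n => (norm_integral_le_integral_norm _).trans (hnorm n)
  have h3 := hS.hasSum
  rw [h1, h2] at h3
  have h4 : ∀ n, ∫ g : SU2, F n g ∂σ₂ = κ ^ n / (n ! : ℝ) * ∫ g : SU2, (su2Quat g).re ^ (k + n) ∂σ₂ := fun n => by
    rw [hF]
    simp only
    rw [integral_const_mul]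
  simpa only [h4] using h3

/-- The partition function as a series: `∫ e^{κ x₀} dσ = Σ_n κ^n/n! ∫ x₀^n dσ` (`= Σ_j κ^(2j) Catalan_j/(4^j (2j)!) =
2 I₁(κ)/κ`). [folklore] -/
theorem hasSum_integral_exp (κ : ℝ) :
    HasSum (fun n : ℕ => κ ^ n / (n ! : ℝ) * ∫ g : SU2, (su2Quat g).re ^ n ∂σ₂)
      (∫ g : SU2, Real.exp (κ * (su2Quat g).re) ∂σ₂) := by
  have h := hasSum_integral_pow_mul_exp 0 κ
  simpa only [zero_add, pow_zero, one_mul] using h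

/-- **Axis reduction**: the exponential moments of every coordinate `⟨x, u⟩`, `|u| = 1`, are those of `x₀`. [folklore] -/
theorem integral_dir_pow_mul_exp (k : ℕ) (κ : ℝ) {u : ℍ} (hu : ‖u‖ = 1) :
    ∫ g : SU2, (su2Quat g * star u).re ^ k * Real.exp (κ * (su2Quat g * star u).re) ∂σ₂ =
      ∫ g : SU2, (su2Quat g).re ^ k * Real.exp (κ * (su2Quat g).re) ∂σ₂ := by
  have hsu : ‖star u‖ = 1 := by rw [norm_star]; exact hu
  have h := integral_comp_units (fun x : ℍ => x.re ^ k * Real.exp (κ * x.re)) norm_one hsu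
  simpa only [one_mul] using h

end Summit.QuantumFields.BalabanUV.InfraRed.StrongCouplingHaarMoments

end
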